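import Literature.GroupTheory.CombinatorialGroupTheory.PuncturedSurfaceGroupVertexTwist
import Literature.GroupTheory.CombinatorialGroupTheory.FreeProductSurfaceSeparation
import Literature.AnabelianGeometry.SemiGraphs.PSCSeparatingCoveringsTwoComponentUnmarked
import Literature.AnabelianGeometry.SemiGraphs.PSCUnrVerticialSeparatingCoveringsTwoComponentAffine
import HarnessLib

/-!
# [CombGC] Prop. 1.2, proof p. 9: verticial separating coverings at the CLOSED-SURFACE carriers `Π = Γ̂_{g,0}` (two unmarked components; the unpointed irreducible nodal curve)

Mochizuki, *A combinatorial version of the Grothendieck conjecture*, Tohoku Math. J. **59** (2007)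
[CombGC], PROOF of Prop. 1.2, p. 9, verticial case: "if `v₁ ≠ v₂` …, then there exists a finite étale …
covering `G' → G` whose restriction to the anabelioid `G_{v₂}` is trivial …, but whose restriction to
the anabelioid `G_{v₁}` is nontrivial" [cite: MochizukiCombGC2007, Prop 1.2 proof p.9], typed LEVEL-WISE
as `PSCDatum.VerticialSeparatingCoverings` (row P12-L01-V of `SUBDAG-CombGC-Prop12.md`, instance form of
abc-iut FACT row F-2826), with Prop. 1.2 (i) verticial and Prop. 1.2 (ii) "the `A_i` are commensurably
terminal" [cite: MochizukiCombGC2007, Prop 1.2(ii) p.8] via abc-iut-w5-d183's reductions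
`verticialOpenInterDeterminesVertex_of_separating` / `commensurator_vertGp_eq_of_separating`.

PROOF-ONLY file (abc-iut-w5-d183 gen 5; row «P12@CLOSED-SURFACE r=0» of abc-iut-L3-lead γ66/γ69).  The
carriers here are the UNPOINTED stable curves, `Π` a pro-`Σ` completion of the CLOSED surface group
`Γ_{g,0}` — NOT free, so the free-basis engines do not apply; the level characters come from the vertex
twist `PuncturedSurfaceGroupVertexTwist.lean` (one surface relator, `PresentedGroup.toGroup`):

* `IsProSigmaCompletion.vertexTwist_exists_open_separating_sameVertex` — the same-vertex separating covering at
  ONE vertex group `cl ι⟨S⟩`, ANY `Γ_{g,r}`, from `ℤ/ℓⁿ`-characters adapted to a set of twisted letters (discrete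
  twist, then transfer along the completion by abc-iut-w5-d047's `exists_open_unrSeparating_of_discrete`, `K = ⊥`);
* `verticialSeparatingCoverings_of_twoComponentClosed`, `verticialRows_of_twoComponentClosed` — F-2826, Prop. 1.2
  (i)-verticial, Prop. 1.2 (ii)-verticial at EVERY two-component one-node datum with BOTH components unmarked
  (`r = 0`; `Π_{v₀} = cl ι⟨a_i, b_i (i<g₀)⟩`, `Π_{v₁} = cl ι⟨a_i, b_i (i≥g₀), ε⟩`, `ε = ∏_{i<g₀}[a_i,b_i]`; e.g. the
  divisor `Δ₁` of `M̄₂`): same-vertex pairs by the twists of the handles `< g₀` resp. `≥ g₀`, cross pairs by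
  abc-iut-f-164's `exists_open_separating_of_character`;
* `verticialSeparatingCoverings_of_irreducibleNodalClosed`, `verticialRows_of_irreducibleNodalClosed` — the same at
  EVERY unpointed irreducible one-nodal datum (`Γ_{g,0}`, `g ≥ 2`; the HNN vertex of the loop; one vertex).

The marked cases (`r ≥ 1`, `Γ` free) are abc-iut-f-164's `PSCSeparatingCoveringsTwoComponentUnmarked.lean` and
abc-iut-w5-d174's `PSCIrreducibleNodalCommTerminal.lean`; NOTHING of those is restated here.  A shape instance is
consistency evidence for the typed schema, not the printed statement for all stable curves; 0 definitions;
nothing here takes a side on [IUTchIII] Cor. 3.12.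
-/

noncomputable section

namespace Literature.AnabelianGeometry.SemiGraphs

open scoped Pointwise
open Literature.AnabelianGeometry.Anabelioids (IsSigmaInteger)
open Literature.GroupTheory.CombinatorialGroupTheory
open Literature.GroupTheory.CombinatorialGroupTheory.PuncturedSurfaceGroup (a b c exists_handleCharacter_zero
  exists_normal_separating_vertexTwist)
open Multiplicative

universe u

/-! ### The same-vertex separating covering from the vertex twist -/

namespace SemiGraphOfAnabelioids.IsProSigmaCompletion

variable {Sigma : Set ℕ} {g r : ℕ} {P : Type*} [Group P] [TopologicalSpace P] [IsTopologicalGroup P]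
  [CompactSpace P] [TotallyDisconnectedSpace P] {ι : PuncturedSurfaceGroup g r →* P}

/-- **[CombGC] Prop. 1.2, proof p. 9 — the verticial separating covering at ONE vertex, vertex-twist form.**
`ι : Γ_{g,r} → Π` a pro-`Σ` completion (`Π` profinite; ANY `r`, in particular `r = 0`), `T` a set of twisted
letters (whole handles, all cusps or none), `S` a generating set of the vertex group containing the twisted
letters, `ℓ ∈ Σ` prime, and for every `n` a character `Φ : Γ_{g,r} → ℤ/ℓⁿ` for which `S` consists of twisted
letters and of untwisted words killed by `Φ`, with `Φ = 1 ∈ ℤ/ℓⁿ` on some `x₀ ∈ ⟨S⟩`; `A = cl ι⟨S⟩`, `V ⊴ Π`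
open.  Then two DISTINCT level vertices `Vγ₁A ≠ Vγ₂A` are separated by an open `U ≤ V`, normal in `V`, with
`γ₂Aγ₂⁻¹ ∩ V ≤ U` and `γ₁Aγ₁⁻¹ ∩ V ⊄ U` (discrete vertex twist at `K = ι⁻¹(V)`, `n = [Γ : K]`, witness
`x₀^n`; transfer along the completion `V` of `K`). [cite: MochizukiCombGC2007, Prop 1.2 proof p.9] -/
theorem vertexTwist_exists_open_separating_sameVertex (hι : IsProSigmaCompletion Sigma ι)
    (T : Set (puncturedSurfaceGen g r)) [DecidablePred (· ∈ T)]
    (hTab : ∀ i : Fin g, (Sum.inl (i, false) : puncturedSurfaceGen g r) ∈ T ↔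
      (Sum.inl (i, true) : puncturedSurfaceGen g r) ∈ T)
    (hTc : (∀ j : Fin r, (Sum.inr j : puncturedSurfaceGen g r) ∈ T) ∨
      ∀ j : Fin r, (Sum.inr j : puncturedSurfaceGen g r) ∉ T)
    (S : Set (PuncturedSurfaceGroup g r))
    (hTS : ∀ s ∈ T, (PresentedGroup.of s : PuncturedSurfaceGroup g r) ∈ Subgroup.closure S)
    {ℓ : ℕ} (hℓ : ℓ.Prime) (hℓS : ℓ ∈ Sigma)
    (hΦ : ∀ n : ℕ, ∃ Φ : PuncturedSurfaceGroup g r →* Multiplicative (ZMod (ℓ ^ n)),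
      (∀ x ∈ S, (∃ s ∈ T, x = PresentedGroup.of s) ∨
        (x ∈ Subgroup.closure ((fun s => (PresentedGroup.of s : PuncturedSurfaceGroup g r)) '' Tᶜ) ∧
          Φ x = 1)) ∧
      ∃ x₀ ∈ Subgroup.closure S, Φ x₀ = ofAdd 1)
    (A : Subgroup P) (hA : A = ((Subgroup.closure S).map ι).topologicalClosure)
    (V : Subgroup P) [hVn : V.Normal] (hVo : IsOpen (V : Set P)) (γ₁ γ₂ : ConjAct P)
    (hne : DoubleCoset.doubleCoset (ConjAct.ofConjAct γ₁) (V : Set P) (A : Set P) ≠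
      DoubleCoset.doubleCoset (ConjAct.ofConjAct γ₂) (V : Set P) (A : Set P)) :
    ∃ U : Subgroup P, IsOpen (U : Set P) ∧ U ≤ V ∧ (U.subgroupOf V).Normal ∧
      (γ₂ • A) ⊓ V ≤ U ∧ ¬ ((γ₁ • A) ⊓ V ≤ U) := by
  classical
  haveI hKfi : (V.comap ι).FiniteIndex := finiteIndex_comap hι V hVo
  set m : ℕ := (V.comap ι).index with hm
  have hmpos : 0 < m := Nat.pos_of_ne_zero Subgroup.FiniteIndex.index_ne_zero
  haveI : NeZero (ℓ ^ m) := ⟨pow_ne_zero _ hℓ.ne_zero⟩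
  have hnm : ¬ ℓ ^ m ∣ m := fun h =>
    absurd (Nat.le_of_dvd hmpos h) (not_le.mpr (Nat.lt_pow_self hℓ.one_lt))
  obtain ⟨Φ, hS, x₀, hx₀S, hΦx₀⟩ := hΦ m
  -- the witness `x₀^m ∈ ⟨S⟩ ∩ K`, seen by `Φ`
  have hyS : x₀ ^ m ∈ Subgroup.closure S := Subgroup.pow_mem _ hx₀S m
  have hyK : x₀ ^ m ∈ V.comap ι := Subgroup.pow_index_mem (V.comap ι) x₀
  have hΦy : Φ (x₀ ^ m) ≠ 1 := by
    rw [map_pow, hΦx₀, ← ofAdd_nsmul, nsmul_eq_mul, mul_one]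
    intro h
    have h' : ((m : ℕ) : ZMod (ℓ ^ m)) = 0 := by simpa using congrArg toAdd h
    exact hnm ((ZMod.natCast_eq_zero_iff m (ℓ ^ m)).mp h')
  -- representatives of the two level vertices in `ι(Γ)`, up to `V`
  obtain ⟨f₁, w₁, hw₁, -, hA₁, hdc₁⟩ := exists_rep_unr hι A ⊥ V hVo γ₁
  obtain ⟨f₂, w₂, hw₂, -, hA₂, hdc₂⟩ := exists_rep_unr hι A ⊥ V hVo γ₂
  rw [sup_bot_eq] at hdc₁ hdc₂
  -- distinct level vertices: `f₁⁻¹ f₂ ∉ ⟨S⟩ · K`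
  have hδ : f₁⁻¹ * f₂ ∉ (Subgroup.closure S : Set (PuncturedSurfaceGroup g r)) * (V.comap ι : Set _) := by
    intro hmem
    obtain ⟨a', ha', k, hk, hak⟩ := Set.mem_mul.mp hmem
    apply hne
    rw [hdc₁, hdc₂]
    symm
    have hkV : ι k ∈ V := hk
    have haA : ι a' ∈ A := by rw [hA]; exact Subgroup.le_topologicalClosure _ (Subgroup.mem_map_of_mem ι ha')
    refine DoubleCoset.doubleCoset_eq_of_mem (DoubleCoset.mem_doubleCoset.mpr
      ⟨ι f₁ * ι a' * ι k * (ι f₁ * ι a')⁻¹, hVn.conj_mem _ hkV (ι f₁ * ι a'), ι a', haA, ?_⟩)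
    have hf₂ : f₂ = f₁ * (a' * k) := by rw [hak, mul_inv_cancel_left]
    rw [hf₂, map_mul, map_mul]
    group
  -- the vertex twist at the discrete level `K = ι⁻¹(V)`
  obtain ⟨U', hU'n, hidx, hfi, hnot, hkill, -⟩ :=
    exists_normal_separating_vertexTwist T hTab hTc Φ S hS hTS (V.comap ι) f₁ (x₀ ^ m) ⟨hyS, hyK⟩ hΦy
  haveI := hU'n
  have hU'S : IsSigmaInteger Sigma U'.index := by
    rw [show Nat.card (Multiplicative (ZMod (ℓ ^ m))) = ℓ ^ m from Nat.card_zmod (ℓ ^ m)] at hidx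
    exact ⟨Nat.pos_of_ne_zero hfi.index_ne_zero, fun p hp hpd =>
      (isSigmaInteger_prime_pow hℓ hℓS m).2 p hp (hpd.trans hidx)⟩
  have halive : ∃ x ∈ (ConjAct.toConjAct f₁ • Subgroup.closure S) ⊓ V.comap ι,
      x ∉ U'.map (V.comap ι).subtype := by
    refine ⟨f₁ * x₀ ^ m * f₁⁻¹, Subgroup.mem_inf.mpr ⟨?_, (inferInstance : (V.comap ι).Normal).conj_mem _ hyK f₁⟩, hnot⟩
    have hfx : f₁ * x₀ ^ m * f₁⁻¹ = ConjAct.toConjAct f₁ • x₀ ^ m := by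
      rw [ConjAct.smul_def, ConjAct.ofConjAct_toConjAct]
    rw [hfx]
    exact Subgroup.smul_mem_pointwise_smul _ _ _ hyS
  -- transfer along the completion `V` of `K`
  obtain ⟨U, hUo, hUV, hUn, hk, ha⟩ := exists_open_unrSeparating_of_discrete hι (Subgroup.closure S)
    (Subgroup.closure S) ⊥ V hVo f₁ f₂ U' hU'S (by rw [sup_bot_eq]; exact hkill f₂ hδ) halive
  haveI := hUn
  refine ⟨U, hUo, hUV, hUn, ?_, ?_⟩
  · rw [hA₂, ← conjAct_smul_eq_of_subgroupOf_normal hUV hw₂, Subgroup.pointwise_smul_le_pointwise_smul_iff]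
    exact le_trans (inf_le_inf_right V (by rw [hA]; exact le_sup_left)) hk
  · rw [hA₁, ← conjAct_smul_eq_of_subgroupOf_normal hUV hw₁, Subgroup.pointwise_smul_le_pointwise_smul_iff, hA]
    exact ha

end SemiGraphOfAnabelioids.IsProSigmaCompletion

/-! ### The closed-surface carriers -/

namespace PSCDatum

open SemiGraphOfAnabelioids (IsProSigmaCompletion)
open SemiGraphOfAnabelioids.IsProSigmaCompletion (vertexTwist_exists_open_separating_sameVertex
  exists_open_separating_of_character)

variable {P : Type u} [Group P] [TopologicalSpace P] [IsTopologicalGroup P]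
variable [CompactSpace P] [TotallyDisconnectedSpace P] {Sigma : Set ℕ} {g : ℕ}

/-- Any character of `Γ_{g,0}` kills the node loop `ε = (∏_{j : Fin 0} …) · ∏_{i<g₀}[a_i,b_i]` of a two-component
unmarked datum. [cite: MochizukiSemiAnbd2006, Ex. 2.10 p.31] -/
private theorem map_nodeLoop_eq_one {M : Type*} [CommGroup M] (Φ : PuncturedSurfaceGroup g 0 →* M) (g₀ : ℕ)
    (ε : PuncturedSurfaceGroup g 0)
    (hε : ε = ((List.finRange 0).map fun j : Fin 0 => if 0 ≤ (j : ℕ) then c (g := g) j else 1).prod *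
      ((List.finRange g).map fun i : Fin g => if (i : ℕ) < g₀ then
        a (r := 0) i * b i * (a i)⁻¹ * (b i)⁻¹ else 1).prod) : Φ ε = 1 := by
  rw [hε, map_mul, map_comm_prod_ite_eq_one Φ, mul_one]
  simp

/-- The node loop `ε` is a word in the letters of the handles `< g₀`. [cite: MochizukiSemiAnbd2006, Ex. 2.10 p.31] -/
private theorem nodeLoop_mem_closure_firstHandles (g₀ : ℕ) (ε : PuncturedSurfaceGroup g 0)
    (hε : ε = ((List.finRange 0).map fun j : Fin 0 => if 0 ≤ (j : ℕ) then c (g := g) j else 1).prod *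
      ((List.finRange g).map fun i : Fin g => if (i : ℕ) < g₀ then
        a (r := 0) i * b i * (a i)⁻¹ * (b i)⁻¹ else 1).prod)
    (H : Subgroup (PuncturedSurfaceGroup g 0)) (ha : ∀ i : Fin g, (i : ℕ) < g₀ → a i ∈ H)
    (hb : ∀ i : Fin g, (i : ℕ) < g₀ → b i ∈ H) : ε ∈ H := by
  rw [hε]
  refine H.mul_mem (by simp) (H.list_prod_mem fun x hx => ?_)
  obtain ⟨i, -, rfl⟩ := List.mem_map.mp hx
  by_cases hi : (i : ℕ) < g₀
  · rw [if_pos hi]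
    exact H.mul_mem (H.mul_mem (H.mul_mem (ha i hi) (hb i hi)) (H.inv_mem (ha i hi))) (H.inv_mem (hb i hi))
  · rw [if_neg hi]
    exact H.one_mem

/-- **Row F-2826 `VerticialSeparatingCoverings` at EVERY two-component one-node datum with BOTH components
unmarked** (`Π` a pro-`Σ` completion of the closed surface group `Γ_{g,0}`, `Π_{v₀} = cl ι⟨a_i, b_i (i<g₀)⟩`,
`Π_{v₁} = cl ι⟨a_i, b_i (i ≥ g₀), ε⟩`, `g₀ ≥ 1`, `g − g₀ ≥ 1`; `V' := V`): same-vertex pairs by the vertex twist of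
the handles `< g₀` (character `a_0 ↦ 1`) resp. `≥ g₀` (character `a_{g₀} ↦ 1`, which kills `ε ∈ [Γ,Γ]`), cross
pairs by the same characters with values in `ℤ`.  The marked case `r ≥ 1` is abc-iut-f-164's
`verticialSeparatingCoverings_of_twoComponentUnmarked`. [cite: MochizukiCombGC2007, Prop 1.2 proof p.9] -/
theorem verticialSeparatingCoverings_of_twoComponentClosed (hne : Sigma.Nonempty)
    (hprime : ∀ p ∈ Sigma, p.Prime) (ι : PuncturedSurfaceGroup g 0 →* P)
    (hι : IsProSigmaCompletion Sigma ι) (G : PSCDatum P) {g₀ : ℕ} (hg₀ : 1 ≤ g₀) (hg₁ : 1 ≤ g - g₀)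
    (v₀ v₁ : G.graph.V) (hV : ∀ w, w = v₀ ∨ w = v₁) (ε : PuncturedSurfaceGroup g 0)
    (hε : ε = ((List.finRange 0).map fun j : Fin 0 =>
            if 0 ≤ (j : ℕ) then PuncturedSurfaceGroup.c (g := g) j else 1).prod *
          ((List.finRange g).map fun i : Fin g => if (i : ℕ) < g₀ then
            PuncturedSurfaceGroup.a (r := 0) i * PuncturedSurfaceGroup.b i *
              (PuncturedSurfaceGroup.a i)⁻¹ * (PuncturedSurfaceGroup.b i)⁻¹ else 1).prod)
    (hV₀ : G.vertGp v₀ = ((Subgroup.closure {x : PuncturedSurfaceGroup g 0 |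
            (∃ i : Fin g, (i : ℕ) < g₀ ∧ (x = PuncturedSurfaceGroup.a i ∨ x = PuncturedSurfaceGroup.b i)) ∨
            ∃ j : Fin 0, 0 ≤ (j : ℕ) ∧ x = PuncturedSurfaceGroup.c j}).map ι).topologicalClosure)
    (hV₁ : G.vertGp v₁ = ((Subgroup.closure {x : PuncturedSurfaceGroup g 0 |
            (∃ i : Fin g, g₀ ≤ (i : ℕ) ∧ (x = PuncturedSurfaceGroup.a i ∨ x = PuncturedSurfaceGroup.b i)) ∨
            (∃ j : Fin 0, (j : ℕ) < 0 ∧ x = PuncturedSurfaceGroup.c j) ∨ x = ε}).map ι).topologicalClosure) :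
    G.VerticialSeparatingCoverings := by
  classical
  obtain ⟨ℓ, hℓS⟩ := hne
  have hℓ : ℓ.Prime := hprime ℓ hℓS
  set i₀ : Fin g := ⟨0, by omega⟩ with hi₀
  set i₁ : Fin g := ⟨g₀, by omega⟩ with hi₁
  -- the twisted letters of the two vertices
  let T₀ : Set (puncturedSurfaceGen g 0) := {s | Sum.elim (fun p : Fin g × Bool => (p.1 : ℕ) < g₀) Fin.elim0 s}
  let T₁ : Set (puncturedSurfaceGen g 0) := {s | Sum.elim (fun p : Fin g × Bool => g₀ ≤ (p.1 : ℕ)) Fin.elim0 s}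
  set S₀ : Set (PuncturedSurfaceGroup g 0) := {x | (∃ i : Fin g, (i : ℕ) < g₀ ∧ (x = a i ∨ x = b i)) ∨
      ∃ j : Fin 0, 0 ≤ (j : ℕ) ∧ x = c j} with hS₀
  set S₁ : Set (PuncturedSurfaceGroup g 0) := {x | (∃ i : Fin g, g₀ ≤ (i : ℕ) ∧ (x = a i ∨ x = b i)) ∨
      (∃ j : Fin 0, (j : ℕ) < 0 ∧ x = c j) ∨ x = ε} with hS₁
  have hTS₀ : ∀ s ∈ T₀, (PresentedGroup.of s : PuncturedSurfaceGroup g 0) ∈ Subgroup.closure S₀ := by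
    rintro (⟨i, bit⟩ | j) hs
    · exact Subgroup.subset_closure (Or.inl ⟨i, hs, by cases bit <;> simp [a, b]⟩)
    · exact j.elim0
  have hTS₁ : ∀ s ∈ T₁, (PresentedGroup.of s : PuncturedSurfaceGroup g 0) ∈ Subgroup.closure S₁ := by
    rintro (⟨i, bit⟩ | j) hs
    · exact Subgroup.subset_closure (Or.inl ⟨i, hs, by cases bit <;> simp [a, b]⟩)
    · exact j.elim0
  have hεPl : ε ∈ Subgroup.closure
      ((fun s => (PresentedGroup.of s : PuncturedSurfaceGroup g 0)) '' T₁ᶜ) := by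
    refine nodeLoop_mem_closure_firstHandles g₀ ε hε _ (fun i hi => ?_) (fun i hi => ?_)
    · exact Subgroup.subset_closure ⟨Sum.inl (i, false), show ¬ g₀ ≤ (i : ℕ) by omega, rfl⟩
    · exact Subgroup.subset_closure ⟨Sum.inl (i, true), show ¬ g₀ ≤ (i : ℕ) by omega, rfl⟩
  have ha₀ : a i₀ ∈ Subgroup.closure S₀ := Subgroup.subset_closure (Or.inl ⟨i₀, by simp [hi₀]; omega, Or.inl rfl⟩)
  have ha₁ : a i₁ ∈ Subgroup.closure S₁ := Subgroup.subset_closure (Or.inl ⟨i₁, by simp [hi₁], Or.inl rfl⟩)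
  -- the characters: `a_{i₀} ↦ 1` kills `Π_{v₁}`'s letters and `ε`; `a_{i₁} ↦ 1` kills `Π_{v₀}`'s letters
  have hchar : ∀ (M : Type) [CommGroup M] (x : M) (i' : Fin g), ∃ Φ : PuncturedSurfaceGroup g 0 →* M,
      Φ (a i') = x ∧ (∀ i, i ≠ i' → Φ (a i) = 1) ∧ ∀ i, Φ (b i) = 1 := by
    intro M _ x i'
    obtain ⟨Φ, hΦa, hΦb⟩ := exists_handleCharacter_zero (g := g) (M := M) (fun i => if i = i' then x else 1)
      fun _ => 1
    exact ⟨Φ, by rw [hΦa, if_pos rfl], fun i hi => by rw [hΦa, if_neg hi], hΦb⟩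
  refine G.verticialSeparatingCoverings_of_sameVertex_of_crossVertex (fun V hVn hVo v γ₁ γ₂ hdc => ?_)
    (fun V hVn hVo w₁ w₂ γ₁ γ₂ hw => ?_)
  · haveI := hVn
    rcases hV v with rfl | rfl
    · refine vertexTwist_exists_open_separating_sameVertex hι T₀ (fun i => Iff.rfl) (Or.inl fun j => j.elim0)
        S₀ hTS₀ hℓ hℓS (fun n => ?_) _ hV₀ V hVo γ₁ γ₂ hdc
      obtain ⟨Φ, hΦa, -, -⟩ := hchar (Multiplicative (ZMod (ℓ ^ n))) (ofAdd 1) i₀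
      refine ⟨Φ, ?_, a i₀, ha₀, hΦa⟩
      rintro x (⟨i, hi, rfl | rfl⟩ | ⟨j, -, -⟩)
      · exact Or.inl ⟨Sum.inl (i, false), hi, rfl⟩
      · exact Or.inl ⟨Sum.inl (i, true), hi, rfl⟩
      · exact j.elim0
    · refine vertexTwist_exists_open_separating_sameVertex hι T₁ (fun i => Iff.rfl) (Or.inl fun j => j.elim0)
        S₁ hTS₁ hℓ hℓS (fun n => ?_) _ hV₁ V hVo γ₁ γ₂ hdc
      obtain ⟨Φ, hΦa, hΦa', hΦb⟩ := hchar (Multiplicative (ZMod (ℓ ^ n))) (ofAdd 1) i₁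
      refine ⟨Φ, ?_, a i₁, ha₁, hΦa⟩
      rintro x (⟨i, hi, rfl | rfl⟩ | ⟨j, -, -⟩ | rfl)
      · exact Or.inl ⟨Sum.inl (i, false), hi, rfl⟩
      · exact Or.inl ⟨Sum.inl (i, true), hi, rfl⟩
      · exact j.elim0
      · exact Or.inr ⟨hεPl, map_nodeLoop_eq_one Φ g₀ x hε⟩
  · haveI := hVn
    rcases hV w₁ with rfl | rfl <;> rcases hV w₂ with rfl | rfl
    · exact absurd rfl hw
    · -- alive `v₀`, killed `v₁`
      obtain ⟨Ψ, hΨa, hΨa', hΨb⟩ := hchar (Multiplicative ℤ) (ofAdd 1) i₀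
      refine exists_open_separating_of_character hι hℓ hℓS Ψ _ (Subgroup.closure S₁) hV₁ ?_ _ (a i₀) ?_ ?_
        V hVo γ₁ γ₂
      · intro x hx
        refine (Subgroup.closure_le Ψ.ker).mpr ?_ hx
        rintro y (⟨i, hi, rfl | rfl⟩ | ⟨j, -, -⟩ | rfl)
        · exact hΨa' i (fun h => by rw [h, hi₀] at hi; simp at hi; omega)
        · exact hΨb i
        · exact j.elim0
        · exact map_nodeLoop_eq_one Ψ g₀ y hε
      · rw [hV₀]; exact Subgroup.le_topologicalClosure _ (Subgroup.mem_map_of_mem ι ha₀)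
      · rw [hΨa]; simp
    · -- alive `v₁`, killed `v₀`
      obtain ⟨Ψ, hΨa, hΨa', hΨb⟩ := hchar (Multiplicative ℤ) (ofAdd 1) i₁
      refine exists_open_separating_of_character hι hℓ hℓS Ψ _ (Subgroup.closure S₀) hV₀ ?_ _ (a i₁) ?_ ?_
        V hVo γ₁ γ₂
      · intro x hx
        refine (Subgroup.closure_le Ψ.ker).mpr ?_ hx
        rintro y (⟨i, hi, rfl | rfl⟩ | ⟨j, -, -⟩)
        · exact hΨa' i (fun h => by rw [h, hi₁] at hi; simp at hi)
        · exact hΨb i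
        · exact j.elim0
      · rw [hV₁]; exact Subgroup.le_topologicalClosure _ (Subgroup.mem_map_of_mem ι ha₁)
      · rw [hΨa]; simp
    · exact absurd rfl hw

/-- **F-2826 with its P12-L02/L03 consequences at every two-component datum with both components unmarked**:
Prop. 1.2 (i) verticial and Prop. 1.2 (ii) for verticial subgroups (abc-iut-w5-d183's reductions).
[cite: MochizukiCombGC2007, Prop 1.2(ii) p.8] -/
theorem verticialRows_of_twoComponentClosed (hne : Sigma.Nonempty)
    (hprime : ∀ p ∈ Sigma, p.Prime) (ι : PuncturedSurfaceGroup g 0 →* P)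
    (hι : IsProSigmaCompletion Sigma ι) (G : PSCDatum P) {g₀ : ℕ} (hg₀ : 1 ≤ g₀) (hg₁ : 1 ≤ g - g₀)
    (v₀ v₁ : G.graph.V) (hV : ∀ w, w = v₀ ∨ w = v₁) (ε : PuncturedSurfaceGroup g 0)
    (hε : ε = ((List.finRange 0).map fun j : Fin 0 =>
            if 0 ≤ (j : ℕ) then PuncturedSurfaceGroup.c (g := g) j else 1).prod *
          ((List.finRange g).map fun i : Fin g => if (i : ℕ) < g₀ then
            PuncturedSurfaceGroup.a (r := 0) i * PuncturedSurfaceGroup.b i *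
              (PuncturedSurfaceGroup.a i)⁻¹ * (PuncturedSurfaceGroup.b i)⁻¹ else 1).prod)
    (hV₀ : G.vertGp v₀ = ((Subgroup.closure {x : PuncturedSurfaceGroup g 0 |
            (∃ i : Fin g, (i : ℕ) < g₀ ∧ (x = PuncturedSurfaceGroup.a i ∨ x = PuncturedSurfaceGroup.b i)) ∨
            ∃ j : Fin 0, 0 ≤ (j : ℕ) ∧ x = PuncturedSurfaceGroup.c j}).map ι).topologicalClosure)
    (hV₁ : G.vertGp v₁ = ((Subgroup.closure {x : PuncturedSurfaceGroup g 0 |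
            (∃ i : Fin g, g₀ ≤ (i : ℕ) ∧ (x = PuncturedSurfaceGroup.a i ∨ x = PuncturedSurfaceGroup.b i)) ∨
            (∃ j : Fin 0, (j : ℕ) < 0 ∧ x = PuncturedSurfaceGroup.c j) ∨ x = ε}).map ι).topologicalClosure) :
    G.VerticialSeparatingCoverings ∧ G.VerticialOpenInterDeterminesVertex ∧
      ∀ A : Subgroup P, G.IsVerticial A → Subgroup.Commensurable.commensurator A = A := by
  have hsep := G.verticialSeparatingCoverings_of_twoComponentClosed hne hprime ι hι hg₀ hg₁ v₀ v₁ hV ε hε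
    hV₀ hV₁
  refine ⟨hsep, G.verticialOpenInterDeterminesVertex_of_separating hsep, ?_⟩
  rintro A ⟨v, γ, rfl⟩
  exact G.commensurator_vertGp_eq_of_separating hsep v γ

/-- **Row F-2826 `VerticialSeparatingCoverings` at EVERY unpointed irreducible one-nodal datum** (`Π` a
pro-`Σ` completion of `Γ_{g,0}`, `g ≥ 2`; ONE vertex `Π_{v₀} = cl ι⟨b_0, a_0 b_0 a_0⁻¹, a_i, b_i (i ≥ 1)⟩`, the
HNN vertex of the loop `b_0`; `V' := V`): all level pairs are same-vertex pairs, separated by the vertex twist of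
the handles `≥ 1` with the character `a_1 ↦ 1` (which kills `b_0` and `a_0 b_0 a_0⁻¹`).  The case with cusps
(`Γ_{g,r+1}`) is abc-iut-w5-d174's `PSCIrreducibleNodalCommTerminal.lean`. [cite: MochizukiCombGC2007, Prop 1.2 proof p.9] -/
theorem verticialSeparatingCoverings_of_irreducibleNodalClosed (hne : Sigma.Nonempty)
    (hprime : ∀ p ∈ Sigma, p.Prime) (ι : PuncturedSurfaceGroup g 0 →* P)
    (hι : IsProSigmaCompletion Sigma ι) (G : PSCDatum P) (hg : 1 ≤ g) (hg2 : 2 ≤ g)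
    (v₀ : G.graph.V) (hV : ∀ w, w = v₀)
    (hV₀ : G.vertGp v₀ = ((Subgroup.closure {x : PuncturedSurfaceGroup g 0 |
        x = PuncturedSurfaceGroup.b ⟨0, hg⟩ ∨
        x = PuncturedSurfaceGroup.a ⟨0, hg⟩ * PuncturedSurfaceGroup.b ⟨0, hg⟩ * (PuncturedSurfaceGroup.a ⟨0, hg⟩)⁻¹ ∨
        (∃ i : Fin g, 1 ≤ (i : ℕ) ∧ (x = PuncturedSurfaceGroup.a i ∨ x = PuncturedSurfaceGroup.b i)) ∨
        ∃ j : Fin 0, x = PuncturedSurfaceGroup.c j}).map ι).topologicalClosure) :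
    G.VerticialSeparatingCoverings := by
  classical
  obtain ⟨ℓ, hℓS⟩ := hne
  have hℓ : ℓ.Prime := hprime ℓ hℓS
  set i₁ : Fin g := ⟨1, by omega⟩ with hi₁
  let T : Set (puncturedSurfaceGen g 0) := {s | Sum.elim (fun p : Fin g × Bool => 1 ≤ (p.1 : ℕ)) Fin.elim0 s}
  set S : Set (PuncturedSurfaceGroup g 0) := {x | x = b ⟨0, hg⟩ ∨ x = a ⟨0, hg⟩ * b ⟨0, hg⟩ * (a ⟨0, hg⟩)⁻¹ ∨
      (∃ i : Fin g, 1 ≤ (i : ℕ) ∧ (x = a i ∨ x = b i)) ∨ ∃ j : Fin 0, x = c j} with hS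
  have hTS : ∀ s ∈ T, (PresentedGroup.of s : PuncturedSurfaceGroup g 0) ∈ Subgroup.closure S := by
    rintro (⟨i, bit⟩ | j) hs
    · refine Subgroup.subset_closure (Or.inr (Or.inr (Or.inl ⟨i, hs, ?_⟩)))
      cases bit
      · exact Or.inl rfl
      · exact Or.inr rfl
    · exact j.elim0
  have ha₁ : a i₁ ∈ Subgroup.closure S :=
    Subgroup.subset_closure (Or.inr (Or.inr (Or.inl ⟨i₁, by simp [hi₁], Or.inl rfl⟩)))
  have hPl : ∀ bit, (PresentedGroup.of (Sum.inl (⟨0, hg⟩, bit)) : PuncturedSurfaceGroup g 0) ∈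
      Subgroup.closure ((fun s => (PresentedGroup.of s : PuncturedSurfaceGroup g 0)) '' Tᶜ) := fun bit =>
    Subgroup.subset_closure ⟨Sum.inl (⟨0, hg⟩, bit), show ¬ (1 ≤ 0) by omega, rfl⟩
  refine G.verticialSeparatingCoverings_of_sameVertex_of_crossVertex (fun V hVn hVo v γ₁ γ₂ hdc => ?_)
    (fun V hVn hVo w₁ w₂ γ₁ γ₂ hw => absurd ((hV w₁).trans (hV w₂).symm) hw)
  haveI := hVn
  obtain rfl := hV v
  refine vertexTwist_exists_open_separating_sameVertex hι T (fun i => Iff.rfl) (Or.inl fun j => j.elim0)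
    S hTS hℓ hℓS (fun n => ?_) _ hV₀ V hVo γ₁ γ₂ hdc
  obtain ⟨Φ, hΦa, hΦb⟩ := exists_handleCharacter_zero (g := g) (M := Multiplicative (ZMod (ℓ ^ n)))
    (fun i => if i = i₁ then ofAdd 1 else 1) fun _ => 1
  have hΦb₀ : Φ (b ⟨0, hg⟩) = 1 := hΦb _
  refine ⟨Φ, ?_, a i₁, ha₁, by rw [hΦa, if_pos rfl]⟩
  rintro x (rfl | rfl | ⟨i, hi, rfl | rfl⟩ | ⟨j, -⟩)
  · exact Or.inr ⟨hPl true, hΦb₀⟩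
  · refine Or.inr ⟨Subgroup.mul_mem _ (Subgroup.mul_mem _ (hPl false) (hPl true)) (Subgroup.inv_mem _ (hPl false)),
      ?_⟩
    rw [map_mul, map_mul, map_inv, hΦb₀, mul_one, mul_inv_cancel]
  · exact Or.inl ⟨Sum.inl (i, false), hi, rfl⟩
  · exact Or.inl ⟨Sum.inl (i, true), hi, rfl⟩
  · exact j.elim0

/-- **F-2826 with its P12-L02/L03 consequences at every unpointed irreducible one-nodal datum**: Prop. 1.2 (i)
verticial and Prop. 1.2 (ii) for verticial subgroups. [cite: MochizukiCombGC2007, Prop 1.2(ii) p.8] -/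
theorem verticialRows_of_irreducibleNodalClosed (hne : Sigma.Nonempty)
    (hprime : ∀ p ∈ Sigma, p.Prime) (ι : PuncturedSurfaceGroup g 0 →* P)
    (hι : IsProSigmaCompletion Sigma ι) (G : PSCDatum P) (hg : 1 ≤ g) (hg2 : 2 ≤ g)
    (v₀ : G.graph.V) (hV : ∀ w, w = v₀)
    (hV₀ : G.vertGp v₀ = ((Subgroup.closure {x : PuncturedSurfaceGroup g 0 |
        x = PuncturedSurfaceGroup.b ⟨0, hg⟩ ∨
        x = PuncturedSurfaceGroup.a ⟨0, hg⟩ * PuncturedSurfaceGroup.b ⟨0, hg⟩ * (PuncturedSurfaceGroup.a ⟨0, hg⟩)⁻¹ ∨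
        (∃ i : Fin g, 1 ≤ (i : ℕ) ∧ (x = PuncturedSurfaceGroup.a i ∨ x = PuncturedSurfaceGroup.b i)) ∨
        ∃ j : Fin 0, x = PuncturedSurfaceGroup.c j}).map ι).topologicalClosure) :
    G.VerticialSeparatingCoverings ∧ G.VerticialOpenInterDeterminesVertex ∧
      ∀ A : Subgroup P, G.IsVerticial A → Subgroup.Commensurable.commensurator A = A := by
  have hsep := G.verticialSeparatingCoverings_of_irreducibleNodalClosed hne hprime ι hι hg hg2 v₀ hV hV₀
  refine ⟨hsep, G.verticialOpenInterDeterminesVertex_of_separating hsep, ?_⟩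
  rintro A ⟨v, γ, rfl⟩
  exact G.commensurator_vertGp_eq_of_separating hsep v γ

end PSCDatum

end Literature.AnabelianGeometry.SemiGraphs

end
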